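import Summits.QuantumFields.YangMills.Theorems.VirialFluxGapRingChartPhase
import Summits.QuantumFields.YangMills.Theorems.LuscherReductionTwistedTraceScalingMagneticQuadratic
import Literature.MathematicalPhysics.QuantumFieldTheory.SUNBakryEmeryPoincare
import HarnessLib

/-!
# Route `VirialFluxGap` (YangMills): the zero-flux ring deficit as a POLYNOMIAL OF THE AMBIENT MATRICES and the one-variable FRAME
# CURVES of the ring group — definitions and structure (part 1 of the `DF` package of the Euler-field hypothesis)

Toward the deciding crux `VirialFluxGap.PeriodicSoftness` (item stmt-QuantumFields-24141).  The virial ∕ IBP reduction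
✓`EulerFieldReduction.periodicSoftness_of_eulerField` consumes, for every translation curve `γ` of the coefficient field, the derivative
of the deficit along the curve: `HasDerivAt (s ↦ F₀(x·γ(s))) (DF t x) t` with `DF` bounded and `DF 0` strongly measurable.  This file
supplies that package ONCE AND FOR ALL for the standard frame curves — one `SU(2)` variable `v` of the ring history turned to the right
along a one-parameter subgroup, `γ_{v,Y}(s) = mulSingle_v(e^{sY})`, `Y ∈ 𝔰𝔲(2)` (✓`SUNBakryEmery.expSU`):

* §1 `ringCoord` ∕ `ringPoly` — the deficit FACTORS THROUGH THE AMBIENT MATRIX SPACE: `F₀ = ringPoly ∘ ringCoord` with `ringCoord P` the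
  family of link ∕ seam matrices and `ringPoly` an explicit degree-`4` polynomial (✓`ChartPhase.ringDeficit_eq_matrix_sums`: temporal bonds
  `2 − Re tr(M M′ᴴ)`, the seam bonds `2 − Re tr(M (g M₀ g′ᴴ)ᴴ)`, the plaquettes `2 − Re tr(M₁M₂M₃ᴴM₄ᴴ)`); `ringPoly` is `C^∞`
  (`contDiff_ringPoly`);
* §2 the frame curves: `sliceCurve i e Y s = (mulSingle i (mulSingle e (expSU Y s)), 1)`, `seamCurve x Y s = (1, mulSingle x (expSU Y s))`;
  `γ 0 = 1`, `γ (s + t) = γ s · γ t`; the coordinates along the curve are `M_w · exp(s·Y_w)` with `Y_w ∈ {Y, 0}` (`ringCoord_mul_sliceCurve`,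
  `ringCoord_mul_seamCurve`), hence differentiable in `s` with derivative the TANGENT FAMILY `sliceTangent ∕ seamTangent`;
* the frame derivatives `sliceFrameDeriv ∕ seamFrameDeriv P = D(ringPoly)(ringCoord P)[tangent P]`; their properties (HasDerivAt along the
  curves, continuity, boundedness, measurability) are the companion module `VirialFluxGapRingDeficitFrameDerivative` (part 2).

HONEST FRAMING: calculus bookkeeping (Mathlib + the landed one-matrix calculus of ✓`SUNBakryEmeryPoincare`); the coefficient functions `φ_j` and
the two pointwise inequalities of the Euler field are NOT here; ⟨24141⟩ stays OPEN; the Yang–Mills mass gap is NOT proved; no summit is proved by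
a line.  Definitions in this file are plumbing abbreviations inside proofs' statements (`ringCoord`, `ringPoly`, the curves, tangents and
`frameDeriv`) — problem-side bookkeeping, no `Prop`, no named fact; 0 `sorry`, standard axioms.  Width seat `ym-line-sfw-p2-w3` g58 (cell
ym-idea-1, free hands), `--supports stmt-QuantumFields-24141`.
References: [cite: arXiv220412737, §2 (2.4) (p. 10)] (left-invariant derivatives on matrix groups); [cite: Luscher1983, §2].
-/

set_option autoImplicit false

noncomputable section

open scoped Matrix BigOperators ContDiff Topology
open MeasureTheory
open Literature.MathematicalPhysics.QuantumFieldTheory hiding SU2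
open Literature.MathematicalPhysics.QuantumLattice
open Literature.MathematicalPhysics.QuantumFieldTheory.SUNBakryEmery (expSU coe_expSU matTop)

namespace Summit.QuantumFields.YangMills.Theorems.VirialFluxGap.FrameDerivative

open Summit.QuantumFields.YangMills.Theorems.FemtoTransferGap
open Summit.QuantumFields.YangMills.Theorems.FemtoTransferGap.TT
open Summit.QuantumFields.YangMills.Theorems.VirialFluxGap.RingDeficit
open Summit.QuantumFields.YangMills.Theorems.VirialFluxGap.ChartPhase

variable {L : ℕ} [NeZero L]

open scoped Matrix.Norms.Frobenius

attribute [local instance 2000] Literature.MathematicalPhysics.QuantumFieldTheory.SUNBakryEmery.matTop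

/-! ## §1 The deficit factors through the ambient matrix space -/

/-- The ambient coordinates of a ring history: its link and seam matrices. [folklore] -/
def ringCoord (L : ℕ) [NeZero L] (P : (Fin (2 * L - 1 + 1) → GaugeConfig 3 L SU2) × (Site 3 L → SU2)) :
    (Fin (2 * L - 1 + 1) → Edge 3 L → Matrix (Fin 2) (Fin 2) ℂ) × (Site 3 L → Matrix (Fin 2) (Fin 2) ℂ) :=
  (fun i e => (P.1 i e : Matrix (Fin 2) (Fin 2) ℂ), fun x => (P.2 x : Matrix (Fin 2) (Fin 2) ℂ))

/-- The zero-flux deficit as a polynomial of the ambient matrices (temporal bonds, seam bonds, plaquettes — the three families of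
✓`ringDeficit_eq_matrix_sums`, inverses written as conjugate transposes). [folklore] -/
def ringPoly (L : ℕ) [NeZero L]
    (M : (Fin (2 * L - 1 + 1) → Edge 3 L → Matrix (Fin 2) (Fin 2) ℂ) × (Site 3 L → Matrix (Fin 2) (Fin 2) ℂ)) : ℝ :=
  (∑ i : Fin (2 * L - 1), ∑ e : Edge 3 L, ((2 : ℝ) - ((M.1 i.castSucc e * (M.1 i.succ e)ᴴ).trace).re)) +
  (∑ e : Edge 3 L, ((2 : ℝ) - ((M.1 (Fin.last (2 * L - 1)) e * (M.2 e.1 * M.1 0 e * (M.2 (e.1.shift e.2))ᴴ)ᴴ).trace).re)) +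
  ∑ j : Fin (2 * L - 1 + 1), ∑ p : Plaquette 3 L,
    ((2 : ℝ) - ((M.1 j (p.1, p.2.1.1) * M.1 j (p.1.shift p.2.1.1, p.2.1.2) * (M.1 j (p.1.shift p.2.1.2, p.2.1.1))ᴴ *
      (M.1 j (p.1, p.2.1.2))ᴴ).trace).re)

/-- The Wilson action of a slice in matrix form: `S(U) = Σ_p (2 − Re tr(U₁U₂U₃ᴴU₄ᴴ))`. [folklore] -/
theorem wilsonAction_eq_matrix_sum (U : GaugeConfig 3 L SU2) :
    wilsonAction su2Rep U = ∑ p : Plaquette 3 L,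
      ((2 : ℝ) - (((U (p.1, p.2.1.1) : Matrix (Fin 2) (Fin 2) ℂ) * (U (p.1.shift p.2.1.1, p.2.1.2) : Matrix (Fin 2) (Fin 2) ℂ) *
        ((U (p.1.shift p.2.1.2, p.2.1.1) : Matrix (Fin 2) (Fin 2) ℂ))ᴴ * ((U (p.1, p.2.1.2) : Matrix (Fin 2) (Fin 2) ℂ))ᴴ).trace).re) := by
  unfold wilsonAction
  refine Finset.sum_congr rfl fun p _ => ?_
  rw [fundamentalRep_apply, TwoLattice.Magnetic.coe_plaquetteHolonomy]
  norm_num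

/-- ★ **The deficit factors through the ambient matrix space**: `F₀ = ringPoly ∘ ringCoord`. [cite: Luscher1983, §2] -/
theorem ringDeficit_eq_ringPoly (P : (Fin (2 * L - 1 + 1) → GaugeConfig 3 L SU2) × (Site 3 L → SU2)) :
    ringDeficit L (fun _ => false) P = ringPoly L (ringCoord L P) := by
  rw [ringDeficit_eq_matrix_sums, twist3_false, ringPoly]
  simp only [ringCoord, wilsonAction_eq_matrix_sum]
  congr 1

/-! ### Smoothness of the polynomial -/

/-- `X ↦ Re tr X` as a real-linear map. [folklore] -/
def reTr : Matrix (Fin 2) (Fin 2) ℂ →ₗ[ℝ] ℝ where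
  toFun X := (X.trace).re
  map_add' X Y := by rw [Matrix.trace_add, Complex.add_re]
  map_smul' c X := by rw [Matrix.trace_smul, RingHom.id_apply, Complex.smul_re, smul_eq_mul]

/-- `X ↦ Xᴴ` as a real-linear map. [folklore] -/
def conjT : Matrix (Fin 2) (Fin 2) ℂ →ₗ[ℝ] Matrix (Fin 2) (Fin 2) ℂ where
  toFun X := Xᴴ
  map_add' X Y := Matrix.conjTranspose_add X Y
  map_smul' c X := by
    rw [RingHom.id_apply]
    ext i j
    simp [Matrix.conjTranspose_apply, Matrix.smul_apply]

/-- `Re tr` is smooth. [folklore] -/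
theorem contDiff_reTr : ContDiff ℝ ∞ fun X : Matrix (Fin 2) (Fin 2) ℂ => (X.trace).re :=
  (LinearMap.toContinuousLinearMap reTr).contDiff

/-- `X ↦ Xᴴ` is smooth. [folklore] -/
theorem contDiff_conjTranspose : ContDiff ℝ ∞ fun X : Matrix (Fin 2) (Fin 2) ℂ => Xᴴ :=
  (LinearMap.toContinuousLinearMap conjT).contDiff

/-- A slice coordinate `M ↦ M.1 i e` is smooth (continuous linear). [folklore] -/
theorem contDiff_coord_fst (i : Fin (2 * L - 1 + 1)) (e : Edge 3 L) :
    ContDiff ℝ ∞ fun M : (Fin (2 * L - 1 + 1) → Edge 3 L → Matrix (Fin 2) (Fin 2) ℂ) × (Site 3 L → Matrix (Fin 2) (Fin 2) ℂ) =>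
      M.1 i e := by
  have h1 : ContDiff ℝ ∞ fun M : (Fin (2 * L - 1 + 1) → Edge 3 L → Matrix (Fin 2) (Fin 2) ℂ) × (Site 3 L → Matrix (Fin 2) (Fin 2) ℂ) =>
      M.1 := contDiff_fst
  have h2 : ContDiff ℝ ∞ fun N : Fin (2 * L - 1 + 1) → Edge 3 L → Matrix (Fin 2) (Fin 2) ℂ => N i :=
    contDiff_apply ℝ (Edge 3 L → Matrix (Fin 2) (Fin 2) ℂ) i
  have h3 : ContDiff ℝ ∞ fun N : Edge 3 L → Matrix (Fin 2) (Fin 2) ℂ => N e := contDiff_apply ℝ (Matrix (Fin 2) (Fin 2) ℂ) e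
  exact h3.comp (h2.comp h1)

/-- A seam coordinate `M ↦ M.2 x` is smooth (continuous linear). [folklore] -/
theorem contDiff_coord_snd (x : Site 3 L) :
    ContDiff ℝ ∞ fun M : (Fin (2 * L - 1 + 1) → Edge 3 L → Matrix (Fin 2) (Fin 2) ℂ) × (Site 3 L → Matrix (Fin 2) (Fin 2) ℂ) =>
      M.2 x := by
  have h1 : ContDiff ℝ ∞ fun M : (Fin (2 * L - 1 + 1) → Edge 3 L → Matrix (Fin 2) (Fin 2) ℂ) × (Site 3 L → Matrix (Fin 2) (Fin 2) ℂ) =>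
      M.2 := contDiff_snd
  have h3 : ContDiff ℝ ∞ fun N : Site 3 L → Matrix (Fin 2) (Fin 2) ℂ => N x := contDiff_apply ℝ (Matrix (Fin 2) (Fin 2) ℂ) x
  exact h3.comp h1

/-- ★ **`ringPoly` is smooth.** [folklore] -/
theorem contDiff_ringPoly : ContDiff ℝ ∞ (ringPoly L) := by
  unfold ringPoly
  have hT : ∀ {f : ((Fin (2 * L - 1 + 1) → Edge 3 L → Matrix (Fin 2) (Fin 2) ℂ) × (Site 3 L → Matrix (Fin 2) (Fin 2) ℂ)) →
      Matrix (Fin 2) (Fin 2) ℂ}, ContDiff ℝ ∞ f → ContDiff ℝ ∞ fun M => (2 : ℝ) - ((f M).trace).re :=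
    fun hf => contDiff_const.sub (contDiff_reTr.comp hf)
  have hC : ∀ {f : ((Fin (2 * L - 1 + 1) → Edge 3 L → Matrix (Fin 2) (Fin 2) ℂ) × (Site 3 L → Matrix (Fin 2) (Fin 2) ℂ)) →
      Matrix (Fin 2) (Fin 2) ℂ}, ContDiff ℝ ∞ f → ContDiff ℝ ∞ fun M => (f M)ᴴ :=
    fun hf => contDiff_conjTranspose.comp hf
  refine ((ContDiff.sum fun i _ => ContDiff.sum fun e _ => hT ?_).add (ContDiff.sum fun e _ => hT ?_)).add
    (ContDiff.sum fun j _ => ContDiff.sum fun p _ => hT ?_)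
  · exact (contDiff_coord_fst _ _).mul (hC (contDiff_coord_fst _ _))
  · exact (contDiff_coord_fst _ _).mul (hC (((contDiff_coord_snd _).mul (contDiff_coord_fst _ _)).mul (hC (contDiff_coord_snd _))))
  · exact (((contDiff_coord_fst _ _).mul (contDiff_coord_fst _ _)).mul (hC (contDiff_coord_fst _ _))).mul (hC (contDiff_coord_fst _ _))

/-- `ringCoord` is continuous. [folklore] -/
theorem continuous_ringCoord : Continuous (ringCoord L) := by
  refine Continuous.prodMk ?_ ?_
  · refine continuous_pi fun i => continuous_pi fun e => ?_
    exact continuous_subtype_val.comp ((continuous_apply e).comp ((continuous_apply i).comp continuous_fst))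
  · refine continuous_pi fun x => ?_
    exact continuous_subtype_val.comp ((continuous_apply x).comp continuous_snd)

/-! ## §2 The frame curves and their tangents -/

/-- The one-variable translation curve turning the slice link `(i, e)` to the right along `Y ∈ 𝔰𝔲(2)`. [folklore] -/
def sliceCurve (i : Fin (2 * L - 1 + 1)) (e : Edge 3 L) {Y : Matrix (Fin 2) (Fin 2) ℂ} (hY : Yᴴ = -Y) (hY0 : Y.trace = 0) (s : ℝ) :
    (Fin (2 * L - 1 + 1) → GaugeConfig 3 L SU2) × (Site 3 L → SU2) :=
  (Pi.mulSingle i (Pi.mulSingle e (expSU (N := 2) hY hY0 s)), 1)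

/-- The one-variable translation curve turning the seam variable at `x` to the right along `Y ∈ 𝔰𝔲(2)`. [folklore] -/
def seamCurve (x : Site 3 L) {Y : Matrix (Fin 2) (Fin 2) ℂ} (hY : Yᴴ = -Y) (hY0 : Y.trace = 0) (s : ℝ) :
    (Fin (2 * L - 1 + 1) → GaugeConfig 3 L SU2) × (Site 3 L → SU2) :=
  (1, Pi.mulSingle x (expSU (N := 2) hY hY0 s))

omit [NeZero L] in
/-- `expSU` at `0` is the identity. [folklore] -/
theorem expSU_zero {Y : Matrix (Fin 2) (Fin 2) ℂ} (hY : Yᴴ = -Y) (hY0 : Y.trace = 0) : expSU (N := 2) hY hY0 0 = 1 := by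
  apply Subtype.ext
  rw [coe_expSU, zero_smul, NormedSpace.exp_zero]; rfl

omit [NeZero L] in
/-- `expSU` is a one-parameter subgroup. [folklore] -/
theorem expSU_add {Y : Matrix (Fin 2) (Fin 2) ℂ} (hY : Yᴴ = -Y) (hY0 : Y.trace = 0) (s t : ℝ) :
    expSU (N := 2) hY hY0 (s + t) = expSU (N := 2) hY hY0 s * expSU (N := 2) hY hY0 t := by
  apply Subtype.ext
  rw [Submonoid.coe_mul, coe_expSU, coe_expSU, coe_expSU, add_smul]
  exact NormedSpace.exp_add_of_commute (((Commute.refl Y).smul_left s).smul_right t)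

omit [NeZero L] in
/-- The slice curve starts at the identity. [folklore] -/
theorem sliceCurve_zero (i : Fin (2 * L - 1 + 1)) (e : Edge 3 L) {Y : Matrix (Fin 2) (Fin 2) ℂ} (hY : Yᴴ = -Y) (hY0 : Y.trace = 0) :
    sliceCurve i e hY hY0 0 = 1 := by
  rw [sliceCurve, expSU_zero, Pi.mulSingle_one, Pi.mulSingle_one]; rfl

omit [NeZero L] in
/-- The seam curve starts at the identity. [folklore] -/
theorem seamCurve_zero (x : Site 3 L) {Y : Matrix (Fin 2) (Fin 2) ℂ} (hY : Yᴴ = -Y) (hY0 : Y.trace = 0) :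
    seamCurve x hY hY0 0 = (1 : (Fin (2 * L - 1 + 1) → GaugeConfig 3 L SU2) × (Site 3 L → SU2)) := by
  rw [seamCurve, expSU_zero, Pi.mulSingle_one]; rfl

omit [NeZero L] in
/-- The slice curve is a one-parameter subgroup of the ring group. [folklore] -/
theorem sliceCurve_add (i : Fin (2 * L - 1 + 1)) (e : Edge 3 L) {Y : Matrix (Fin 2) (Fin 2) ℂ} (hY : Yᴴ = -Y) (hY0 : Y.trace = 0)
    (s t : ℝ) : sliceCurve i e hY hY0 (s + t) = sliceCurve i e hY hY0 s * sliceCurve i e hY hY0 t := by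
  rw [sliceCurve, sliceCurve, sliceCurve, Prod.mk_mul_mk, mul_one, ← Pi.mulSingle_mul, ← Pi.mulSingle_mul, expSU_add]

omit [NeZero L] in
/-- The seam curve is a one-parameter subgroup of the ring group. [folklore] -/
theorem seamCurve_add (x : Site 3 L) {Y : Matrix (Fin 2) (Fin 2) ℂ} (hY : Yᴴ = -Y) (hY0 : Y.trace = 0) (s t : ℝ) :
    seamCurve x hY hY0 (s + t) = seamCurve x hY hY0 s * seamCurve x hY hY0 t := by
  rw [seamCurve, seamCurve, seamCurve, Prod.mk_mul_mk, mul_one, ← Pi.mulSingle_mul, expSU_add]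

/-- The direction family of the slice curve: `Y` at `(i, e)`, `0` elsewhere. [folklore] -/
def sliceDir (i : Fin (2 * L - 1 + 1)) (e : Edge 3 L) (Y : Matrix (Fin 2) (Fin 2) ℂ) (i' : Fin (2 * L - 1 + 1)) (e' : Edge 3 L) :
    Matrix (Fin 2) (Fin 2) ℂ :=
  if i' = i ∧ e' = e then Y else 0

/-- The direction family of the seam curve: `Y` at `x`, `0` elsewhere. [folklore] -/
def seamDir (x : Site 3 L) (Y : Matrix (Fin 2) (Fin 2) ℂ) (x' : Site 3 L) : Matrix (Fin 2) (Fin 2) ℂ :=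
  if x' = x then Y else 0

/-- ★ **Coordinates along the slice curve**: every slice link is `M · exp(s·Y_w)` with `Y_w ∈ {Y, 0}`, the seam is unchanged. [folklore] -/
theorem ringCoord_mul_sliceCurve (i : Fin (2 * L - 1 + 1)) (e : Edge 3 L) {Y : Matrix (Fin 2) (Fin 2) ℂ} (hY : Yᴴ = -Y) (hY0 : Y.trace = 0)
    (P : (Fin (2 * L - 1 + 1) → GaugeConfig 3 L SU2) × (Site 3 L → SU2)) (s : ℝ) :
    ringCoord L (P * sliceCurve i e hY hY0 s) =
      (fun i' e' => (P.1 i' e' : Matrix (Fin 2) (Fin 2) ℂ) * NormedSpace.exp (s • sliceDir i e Y i' e'), fun x => (P.2 x : Matrix (Fin 2) (Fin 2) ℂ)) := by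
  unfold ringCoord sliceCurve sliceDir
  refine Prod.ext ?_ ?_
  · funext i' e'
    simp only [Prod.fst_mul, Pi.mul_apply, Submonoid.coe_mul]
    by_cases hi : i' = i
    · subst hi
      rw [Pi.mulSingle_eq_same]
      by_cases he : e' = e
      · subst he; rw [Pi.mulSingle_eq_same, coe_expSU, if_pos ⟨rfl, rfl⟩]; rfl
      · rw [Pi.mulSingle_eq_of_ne he, if_neg (fun h => he h.2), smul_zero, NormedSpace.exp_zero]; rfl
    · rw [Pi.mulSingle_eq_of_ne hi, Pi.one_apply, if_neg (fun h => hi h.1), smul_zero, NormedSpace.exp_zero]; rfl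
  · funext x
    simp only [Prod.snd_mul, mul_one]

/-- ★ **Coordinates along the seam curve**: every seam variable is `M · exp(s·Y_w)` with `Y_w ∈ {Y, 0}`, the slices are unchanged. [folklore] -/
theorem ringCoord_mul_seamCurve (x : Site 3 L) {Y : Matrix (Fin 2) (Fin 2) ℂ} (hY : Yᴴ = -Y) (hY0 : Y.trace = 0)
    (P : (Fin (2 * L - 1 + 1) → GaugeConfig 3 L SU2) × (Site 3 L → SU2)) (s : ℝ) :
    ringCoord L (P * seamCurve x hY hY0 s) =
      (fun i' e' => (P.1 i' e' : Matrix (Fin 2) (Fin 2) ℂ), fun x' => (P.2 x' : Matrix (Fin 2) (Fin 2) ℂ) * NormedSpace.exp (s • seamDir x Y x')) := by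
  unfold ringCoord seamCurve seamDir
  refine Prod.ext ?_ ?_
  · funext i' e'
    simp only [Prod.fst_mul, mul_one]
  · funext x'
    simp only [Prod.snd_mul, Pi.mul_apply, Submonoid.coe_mul]
    by_cases hx : x' = x
    · subst hx; rw [Pi.mulSingle_eq_same, coe_expSU, if_pos rfl]; rfl
    · rw [Pi.mulSingle_eq_of_ne hx, if_neg hx, smul_zero, NormedSpace.exp_zero]; rfl

/-- The tangent family of the slice curve at a ring history: `M_w · Y_w` on the slices, `0` on the seam. [folklore] -/
def sliceTangent (i : Fin (2 * L - 1 + 1)) (e : Edge 3 L) (Y : Matrix (Fin 2) (Fin 2) ℂ)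
    (P : (Fin (2 * L - 1 + 1) → GaugeConfig 3 L SU2) × (Site 3 L → SU2)) :
    (Fin (2 * L - 1 + 1) → Edge 3 L → Matrix (Fin 2) (Fin 2) ℂ) × (Site 3 L → Matrix (Fin 2) (Fin 2) ℂ) :=
  (fun i' e' => (P.1 i' e' : Matrix (Fin 2) (Fin 2) ℂ) * sliceDir i e Y i' e', fun _ => 0)

/-- The tangent family of the seam curve at a ring history: `0` on the slices, `M_w · Y_w` on the seam. [folklore] -/
def seamTangent (x : Site 3 L) (Y : Matrix (Fin 2) (Fin 2) ℂ)
    (P : (Fin (2 * L - 1 + 1) → GaugeConfig 3 L SU2) × (Site 3 L → SU2)) :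
    (Fin (2 * L - 1 + 1) → Edge 3 L → Matrix (Fin 2) (Fin 2) ℂ) × (Site 3 L → Matrix (Fin 2) (Fin 2) ℂ) :=
  (fun _ _ => 0, fun x' => (P.2 x' : Matrix (Fin 2) (Fin 2) ℂ) * seamDir x Y x')

/-- The frame derivative of the zero-flux deficit along the slice curve, at a ring history: `D(ringPoly)(ringCoord P)[sliceTangent P]`
(the left-invariant derivative of Shen–Zhu–Zhu §2 (2.4), one variable at a time). [folklore] -/
def sliceFrameDeriv (i : Fin (2 * L - 1 + 1)) (e : Edge 3 L) (Y : Matrix (Fin 2) (Fin 2) ℂ)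
    (P : (Fin (2 * L - 1 + 1) → GaugeConfig 3 L SU2) × (Site 3 L → SU2)) : ℝ :=
  fderiv ℝ (ringPoly L) (ringCoord L P) (sliceTangent i e Y P)

/-- The frame derivative of the zero-flux deficit along the seam curve, at a ring history. [folklore] -/
def seamFrameDeriv (x : Site 3 L) (Y : Matrix (Fin 2) (Fin 2) ℂ)
    (P : (Fin (2 * L - 1 + 1) → GaugeConfig 3 L SU2) × (Site 3 L → SU2)) : ℝ :=
  fderiv ℝ (ringPoly L) (ringCoord L P) (seamTangent x Y P)

end Summit.QuantumFields.YangMills.Theorems.VirialFluxGap.FrameDerivative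

end
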